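import Mathlib.Data.Finset.SymmDiff
import Mathlib.Data.Fintype.Basic

/-!
# Set identities for Theorem W (Conjecture V, completions of residue instances)

Boolean identities between finsets used by `ExcessOneCompletionFlip.lean`,
`ExcessOneCompletionSteps.lean` and `ExcessOneCompletionMain.lean` (Theorem W of
proofs/MINE1-theoremS.md, Addendum 12: every completion of a residue instance is `∅` or `univ`).
They are stated for free variables so that each is closed by `ext` + `simp only` + `tauto` in a
clean context. Naming: `M` is the addable part of a tight family, `u` the near-member, `x` a set
disjoint from `M` and `y` a subset of `M`.
-/

namespace PercRepro.MSTight

open Finset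
open scoped symmDiff

variable {α : Type*} [DecidableEq α]

section NoFintype

variable (x y M u : Finset α)

/-- The agreement cell `t ∩ u` of the member `x ∪ M`, inside `M`. -/
theorem idW_union_inter_inter : ((x ∪ M) ∩ u) ∩ M = u ∩ M := by
  ext a; simp only [mem_inter, mem_union]; tauto

/-- The disagreement cell `t \ u` of the member `x ∪ M`, inside `M`. -/
theorem idW_union_sdiff_inter : ((x ∪ M) \ u) ∩ M = M \ u := by
  ext a; simp only [mem_inter, mem_sdiff, mem_union]; tauto

/-- The disagreement cell `u \ t` of the member `x ∪ M`, outside `M`. -/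
theorem idW_sdiff_union_sdiff : (u \ (x ∪ M)) \ M = (u \ M) \ x := by
  ext a; simp only [mem_sdiff, mem_union, not_or]; tauto

/-- The agreement cell `t ∩ u` of the member `M \ y`, inside `M`. -/
theorem idW_sdiff_inter_inter : ((M \ y) ∩ u) ∩ M = (M ∩ u) \ y := by
  ext a; simp only [mem_inter, mem_sdiff]; tauto

/-- The disagreement cell `t \ u` of the member `M \ y`, inside `M`. -/
theorem idW_sdiff_sdiff_inter : ((M \ y) \ u) ∩ M = (M \ y) \ u := by
  ext a; simp only [mem_inter, mem_sdiff]; tauto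

/-- The disagreement cell `u \ t` of the member `M \ y`, outside `M`. -/
theorem idW_sdiff_sdiff_sdiff : (u \ (M \ y)) \ M = u \ M := by
  ext a; simp only [mem_sdiff, not_and, not_not]; tauto

/-- Removing a set disjoint from `u` changes nothing. -/
theorem idW_sdiff_sdiff_of_disjoint {x u : Finset α} (h : Disjoint x u) (M : Finset α) :
    (u \ M) \ x = u \ M := by
  ext a
  have hd : a ∈ u → a ∉ x := fun h' => Finset.disjoint_right.1 h h'
  simp only [mem_sdiff]
  tauto

/-- Removing a subset of `u` before removing `u` changes nothing. -/
theorem idW_sdiff_sdiff_of_subset {y u : Finset α} (h : y ⊆ u) (M : Finset α) :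
    (M \ y) \ u = M \ u := by
  ext a
  have hs : a ∈ y → a ∈ u := fun h' => h h'
  simp only [mem_sdiff]
  tauto

/-- The agreement cell of `M ∩ u = M \ (M \ u)` inside `M`. -/
theorem idW_inter_sdiff_sdiff : (M ∩ u) \ (M \ u) = u ∩ M := by
  ext a; simp only [mem_inter, mem_sdiff, not_and, not_not]; tauto

/-- The outer part of the pair member `x ∪ (M \ y)`. -/
theorem idW_pair_sdiff {x y M : Finset α} (hxM : Disjoint x M) : (x ∪ (M \ y)) \ M = x := by
  ext a
  have hd : a ∈ x → a ∉ M := fun h => Finset.disjoint_left.1 hxM h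
  simp only [mem_sdiff, mem_union]
  tauto

/-- The inner part of the pair member `x ∪ (M \ y)`. -/
theorem idW_pair_sdiff' {x y M : Finset α} (hxM : Disjoint x M) (hyM : y ⊆ M) :
    M \ (x ∪ (M \ y)) = y := by
  ext a
  have hd : a ∈ M → a ∉ x := fun h => Finset.disjoint_right.1 hxM h
  have hs : a ∈ y → a ∈ M := fun h => hyM h
  simp only [mem_sdiff, mem_union, not_or, not_and, not_not]
  tauto

end NoFintype

section WithFintype

variable [Fintype α] (x y M u : Finset α)

/-- The part of the complement of `u` inside `M`. -/
theorem idW_sdiff_univ_sdiff : M \ (Finset.univ \ u) = u ∩ M := by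
  ext a; simp only [mem_sdiff, mem_inter, mem_univ, true_and, not_not]; tauto

/-- The agreement cell `tᶜ ∩ uᶜ` of the member `x ∪ M`, outside `M`. -/
theorem idW_compl_union_inter_sdiff : ((Finset.univ \ (x ∪ M)) ∩ (Finset.univ \ u)) \ M =
    ((Finset.univ \ u) \ M) \ x := by
  ext a; simp only [mem_sdiff, mem_inter, mem_union, mem_univ, true_and, not_or]; tauto

/-- The agreement cell `tᶜ ∩ uᶜ` of the member `M \ y`, outside `M`. -/
theorem idW_compl_sdiff_inter_sdiff : ((Finset.univ \ (M \ y)) ∩ (Finset.univ \ u)) \ M =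
    (Finset.univ \ u) \ M := by
  ext a; simp only [mem_sdiff, mem_inter, mem_univ, true_and, not_and, not_not]; tauto

/-- The outer part of the complement of the pair member `x ∪ (M \ y)`. -/
theorem idW_pair_compl_sdiff : (Finset.univ \ (x ∪ (M \ y))) \ M = (Finset.univ \ M) \ x := by
  ext a; simp only [mem_sdiff, mem_union, mem_univ, true_and, not_or, not_and, not_not]; tauto

/-- The inner part of the complement of the pair member `x ∪ (M \ y)`. -/
theorem idW_pair_compl_sdiff' {x y M : Finset α} (hxM : Disjoint x M) :
    M \ (Finset.univ \ (x ∪ (M \ y))) = M \ y := by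
  ext a
  have hd : a ∈ M → a ∉ x := fun h => Finset.disjoint_right.1 hxM h
  simp only [mem_sdiff, mem_union, mem_univ, true_and, not_or, not_and, not_not]
  tauto

/-- A set equal to the complement of the pair member `x ∪ (M \ y)` and containing `M` is
contained in `y`. -/
theorem idW_pair_compl_subset {x y M : Finset α}
    (h : Finset.univ \ (x ∪ (M \ y)) = M) : M ⊆ y := by
  intro a ha
  have h1 : a ∈ Finset.univ \ (x ∪ (M \ y)) := by
    rw [h]
    exact ha
  simp only [mem_sdiff, mem_union, mem_univ, true_and, not_or, not_and, not_not] at h1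
  exact h1.2 ha

end WithFintype

end PercRepro.MSTight
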